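import Summits.ValiantsHypothesis.ValiantsHypothesis.Theorems.BarrierLeverPartitionMinorsMooreBench

/-!
# Route BarrierLever — item 20172 (CPM), benchmark row 14: ENTRIES OF THE PEEL ROWS after the
# one-point substitution `Y_n ↦ X` (memo g18 §2.1 (E), §2.3): the attached rows of the peeled point,
# the pair rows through the peeled point, and the fixed rows

Helper file (`--supports stmt-ValiantsHypothesis-20172`; cell valiant-natproofs, rung V4, 𝒟-side of
door (c), benchmark «row 14»; seat valiant-natproofs-prover gen 14).  Closes NO item.  One auxiliary
definition (`inclFactorial`, the entries `[T_j ⊆ T_c] · |T_c ∖ T_j|!` of the unbounded peel matrix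
`G̃`; `peelMatrix i = G̃` on the window, `peelMatrix_eq_inclFactorial`); otherwise lemmas about
`rowVec` of `…MooreBench` over a polynomial ring `R[X]` with a node table `Z : ℕ → R[X]` whose peeled
point carries `Z n = X` and whose other points are constants `Z b = C (Y b)`:

* `X_pow_mul_rowVec_single` — `X^j · (T_j,{n})-row = (col ↦ C (G̃[j, col]) · X^col)`;
  `rowVec_single_sub_fixed` — after subtracting the fixed monomial rows `e_m`, `m < c_i`, the row
  is `col ↦ [c_i ≤ col] · C (G̃[j, col]) · X^col` (memo §2.3, group `S' = ∅`).
* `rowVec_pair_eq_sum` — the pair row `(∅,{b,n})` is `Σ_{d ⊆ T} C(|T∖d|!·Y_b^{bin(T∖d)}·|d|!) · X^{bin d}`;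
  `rowVec_pair_sub_fixed` — after subtracting `|T_j'|! X^{j'} · (T_{j'},{b})`, `j' < i`, only the
  terms with `bin d ≥ i` survive (memo §2.3, group `S' = {b}`); `coeff_sum_C_mul_X_pow_bin` reads off
  the coefficients of such sums (`coeff_e = κ (bits e)`).
* `rowVec_eq_C_of_mem_stageRows` — rows alive at stage `(i, n)` do not see the point `n`: they are
  constants.

WHAT THIS IS NOT: bookkeeping for the peel step (file `…MooreBenchPeel`); nothing on items 20172 /
20195 / 19717, crux stmt-ValiantsHypothesis-14610, or `VP` versus `VNP`.
-/

set_option linter.dupNamespace false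

namespace Summit.ValiantsHypothesis.ValiantsHypothesis.Theorems.BarrierLever.MoorePeel

open Polynomial Finset

/-- The entries of the unbounded peel matrix `G̃[j, c] = [T_j ⊆ T_c] · |T_c ∖ T_j|!`
(codes read as bit-sets; `peelMatrix i j m = G̃[j, c_i + m]`). -/
def inclFactorial (j c : ℕ) : ℕ :=
  if bits j ⊆ bits c then ((bits c).card - (bits j).card).factorial else 0

/-- The peel matrix is the window block of `G̃`. -/
theorem peelMatrix_eq_inclFactorial (i : ℕ) (j m : Fin i) :
    peelMatrix i j m = (inclFactorial (j : ℕ) (windowStart i + (m : ℕ)) : ℤ) := by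
  rw [peelMatrix_apply, inclFactorial]
  split_ifs <;> simp

/-- Off its support `G̃` vanishes. -/
theorem inclFactorial_of_not_subset {j c : ℕ} (hjc : ¬ bits j ⊆ bits c) : inclFactorial j c = 0 := by
  rw [inclFactorial, if_neg hjc]

section Entries

variable {R : Type*} [CommRing R] (r : ℕ)

/-- For `T_j ⊆ T_c`: `j + bin (T_c ∖ T_j) = c`. -/
theorem add_bin_sdiff_eq {j c : ℕ} (hjc : bits j ⊆ bits c) : j + bin (bits c \ bits j) = c := by
  have e : bin (bits c \ bits j) + bin (bits j) = bin (bits c) := Finset.sum_sdiff hjc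
  rw [bin_bits, bin_bits] at e
  omega

/-- **The attached rows of the peeled point.**  If `Z n = X` then
`X^j · rowVec (T_j, {n}) col = C (G̃[j, col]) · X^col`. -/
theorem X_pow_mul_rowVec_single (Z : ℕ → R[X]) (n : ℕ) (hZ : Z n = X) (j : ℕ) (col : Fin r) :
    X ^ j * rowVec r Z (Sum.inr (Sum.inl (j, n))) col =
      C ((inclFactorial j (col : ℕ) : R)) * X ^ (col : ℕ) := by
  simp only [rowVec, hZ, inclFactorial]
  split_ifs with hsub
  · rw [mul_left_comm, ← pow_add, add_bin_sdiff_eq hsub, map_natCast]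
  · simp

/-- **Group `S' = ∅` after row reduction.**  Subtracting the fixed monomial rows `e_m`, `m < c_i`,
from `X^j · (T_j, {n})` leaves `col ↦ [c_i ≤ col] · C (G̃[j, col]) · X^col`. -/
theorem rowVec_single_sub_fixed (Z : ℕ → R[X]) (n : ℕ) (hZ : Z n = X) (i j : ℕ) (col : Fin r) :
    X ^ j * rowVec r Z (Sum.inr (Sum.inl (j, n))) col -
      ∑ m ∈ Finset.range (windowStart i), (C ((inclFactorial j m : R)) * X ^ m) *
        (if (col : ℕ) = m then (1 : R[X]) else 0) =
      if (col : ℕ) < windowStart i then 0 else C ((inclFactorial j (col : ℕ) : R)) * X ^ (col : ℕ) := by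
  rw [X_pow_mul_rowVec_single r Z n hZ j col]
  simp_rw [mul_ite, mul_one, mul_zero]
  rw [Finset.sum_ite_eq (Finset.range (windowStart i)) (col : ℕ)]
  simp only [Finset.mem_range]
  split_ifs with hlt
  · exact sub_self _
  · exact sub_zero _

/-- **The pair rows through the peeled point.**  If `Z n = X` and `Z b = C y` then
`rowVec (∅, {b, n}) col = Σ_{d ⊆ T_col} C(|T∖d|! · y^{bin(T∖d)} · |d|!) · X^{bin d}`. -/
theorem rowVec_pair_eq_sum (Z : ℕ → R[X]) (n b : ℕ) (y : R) (hZn : Z n = X) (hZb : Z b = C y)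
    (col : Fin r) :
    rowVec r Z (Sum.inr (Sum.inr (b, n))) col = ∑ d ∈ (bits (col : ℕ)).powerset,
      C ((((bits (col : ℕ)) \ d).card.factorial : R) * y ^ bin (bits (col : ℕ) \ d) *
        (d.card.factorial : R)) * X ^ bin d := by
  simp only [rowVec, hZn, hZb]
  refine Finset.sum_congr rfl fun d _ => ?_
  rw [map_mul, map_mul, map_pow, map_natCast, map_natCast]
  ring

/-- Coefficients of a sum `Σ_{d ∈ 𝒟} C (κ d) · X^{bin d}`: the degree-`e` coefficient is
`κ (bits e)` if `bits e ∈ 𝒟`, else `0`. -/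
theorem coeff_sum_C_mul_X_pow_bin (𝒟 : Finset (Finset ℕ)) (κ : Finset ℕ → R) (e : ℕ) :
    (∑ d ∈ 𝒟, C (κ d) * X ^ bin d).coeff e = if bits e ∈ 𝒟 then κ (bits e) else 0 := by
  rw [Polynomial.finsetSum_coeff]
  simp_rw [Polynomial.coeff_C_mul_X_pow]
  have key : ∀ d ∈ 𝒟, (if e = bin d then κ d else 0) = if d = bits e then κ d else 0 := by
    intro d _
    by_cases hd : d = bits e
    · rw [if_pos hd, if_pos (by rw [hd, bin_bits])]
    · rw [if_neg hd, if_neg (fun he => hd (by rw [he, bits_bin]))]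
  rw [Finset.sum_congr rfl key, Finset.sum_ite_eq']

/-- **Group `S' = {b}` after row reduction.**  With `Z n = X`, `Z b = C (Y b)`: subtracting
`|T_{j'}|! · X^{j'} · (T_{j'}, {b})` for `j' < i` from the pair row `(∅, {b, n})` leaves exactly the
terms with `bin d ≥ i`. -/
theorem rowVec_pair_sub_fixed (Y : ℕ → R) (Z : ℕ → R[X]) (n b i : ℕ) (hZn : Z n = X)
    (hZb : Z b = C (Y b)) (col : Fin r) :
    rowVec r Z (Sum.inr (Sum.inr (b, n))) col -
      ∑ j' ∈ Finset.range i, (C (((bits j').card.factorial : R)) * X ^ j') *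
        C (rowVec r Y (Sum.inr (Sum.inl (j', b))) col) =
    ∑ d ∈ (bits (col : ℕ)).powerset.filter (fun d => i ≤ bin d),
      C ((((bits (col : ℕ)) \ d).card.factorial : R) * Y b ^ bin (bits (col : ℕ) \ d) *
        (d.card.factorial : R)) * X ^ bin d := by
  rw [rowVec_pair_eq_sum r Z n b (Y b) hZn hZb col, sub_eq_iff_eq_add,
    ← Finset.sum_filter_add_sum_filter_not (bits (col : ℕ)).powerset (fun d => i ≤ bin d)]
  congr 1
  -- the terms with `bin d < i` are the subtracted attached rows, reindexed by `d = bits j'`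
  set T := bits (col : ℕ) with hT
  have hsub0 : ∀ j' ∈ Finset.range i, ¬ bits j' ⊆ T →
      (C (((bits j').card.factorial : R)) * X ^ j') *
        C (rowVec r Y (Sum.inr (Sum.inl (j', b))) col) = 0 := by
    intro j' _ hj'
    simp only [rowVec, ← hT, if_neg hj', map_zero, mul_zero]
  rw [← Finset.sum_filter_of_ne (s := Finset.range i) (p := fun j' => bits j' ⊆ T)
    (fun j' hj' hne => by_contra fun hns => hne (hsub0 j' hj' hns))]
  have himage : (T.powerset.filter fun d => ¬ i ≤ bin d) =
      ((Finset.range i).filter fun j' => bits j' ⊆ T).image bits := by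
    ext d
    simp only [Finset.mem_filter, Finset.mem_powerset, Finset.mem_image, Finset.mem_range, not_le]
    constructor
    · rintro ⟨hdT, hdi⟩
      exact ⟨bin d, ⟨hdi, by rwa [bits_bin]⟩, bits_bin d⟩
    · rintro ⟨j', ⟨hj'i, hj'T⟩, rfl⟩
      exact ⟨hj'T, by rwa [bin_bits]⟩
  rw [himage, Finset.sum_image fun a _ b _ e => bits_injective e]
  refine Finset.sum_congr rfl fun j' hj' => ?_
  have hj'T : bits j' ⊆ T := (Finset.mem_filter.mp hj').2
  simp only [rowVec, ← hT, if_pos hj'T, bin_bits, Finset.card_sdiff_of_subset hj'T, map_mul, map_pow,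
    map_natCast]
  ring

/-- **Fixed rows are constants.**  A row alive at stage `(i, n)` involves only points `< n`; if the
node table `Z` is `C ∘ Y` there, the row over `R[X]` is the constant row `C ∘ rowVec r Y x`. -/
theorem rowVec_eq_C_of_mem_stageRows (Y : ℕ → R) (Z : ℕ → R[X]) (i n : ℕ)
    (hZ : ∀ b, b < n → Z b = C (Y b)) (x : RowLabel) (hx : x ∈ stageRows i n) (col : Fin r) :
    rowVec r Z x col = C (rowVec r Y x col) := by
  rw [map_rowVec]
  rcases x with m | ⟨j, b⟩ | ⟨b, b'⟩
  · rfl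
  · have hb : b < n := (inr_inl_mem_stageRows.mp hx).2
    rw [rowVec_congr r Z (fun b => C (Y b)) (Sum.inr (Sum.inl (j, b)))
      (fun b₁ hb₁ => by rw [hb₁]; exact hZ b hb)]
  · have hbb : b < b' ∧ b' < n := inr_inr_mem_stageRows.mp hx
    rw [rowVec_congr r Z (fun b => C (Y b)) (Sum.inr (Sum.inr (b, b')))
      (fun b₁ hb₁ => by
        rcases hb₁ with e | e
        · rw [e]; exact hZ b (lt_trans hbb.1 hbb.2)
        · rw [e]; exact hZ b' hbb.2)]

end Entries

end Summit.ValiantsHypothesis.ValiantsHypothesis.Theorems.BarrierLever.MoorePeel
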